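import Mathlib
import Summits.Ventures.PercRepro2.Defs
import Summits.Ventures.PercRepro2.Graph
import Summits.Ventures.PercRepro2.OneColourSwitch
import Summits.Ventures.PercRepro2.RegionHubSign
import Summits.Ventures.PercRepro2.SideSwitch
import Summits.Ventures.PercRepro2.SideSwitchFibre
import Summits.Ventures.PercRepro2.SideSwitchComps
import Summits.Ventures.PercRepro2.M9NoPocketDefs
import Summits.Ventures.PercRepro2.M9NoPocketWorld
import Summits.Ventures.PercRepro2.M9NoPocketWorldD
import Summits.Ventures.PercRepro2.M9NoPocketLegal
import Summits.Ventures.PercRepro2.M9NoPocketMono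
import Summits.Ventures.PercRepro2.M9NoPocketCompl
import Summits.Ventures.PercRepro2.M9NoPocketFreeBlock
import Summits.Ventures.PercRepro2.M9NoPocketFreeBlockK
import Summits.Ventures.PercRepro2.M9QuadHarrisPow
import Summits.Ventures.PercRepro2.M9NoPocketSameType
import Summits.Ventures.PercRepro2.M9NoPocketDeadPattern
import Summits.Ventures.PercRepro2.M9NoPocketSigmaRS
import Summits.Ventures.PercRepro2.M9NoPocketUnitK

/-!
# The reached sum of a same-type representative and its dead patterns (blind cell PercRepro2,
p3 g36, 2026-08-29; `proofs/P3-NPHDR.md` §5, the unit coordinates)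

For a same-type representative `ρ` write `inner ρ D` for the sum over the legal vectors of the
dead pattern `flipF D ρ` of `[d ∈ K₂]·σ_pq σ_rs`.  The pattern `D = A` (every edge at `d`
dead) contributes nothing (`inner_all_dead_eq_zero`); a pattern `∅ ≠ D ≠ A` contributes its
`K`-points, the subsets of the free blocks (`inner_eq_K_sum`); the pattern `D = ∅` contributes
the type-`E` points — the doubly-reached ones (`∅ ≠ S ⊊ 𝔑`) and the clean `K`-points
(`S = ∅`) — (`inner_empty_eq`, through the product decomposition `X = (X ∩ 𝔉) ∪ (X ∩ 𝔑)` of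
the block subsets, `sum_powerset_blocks_eq`).  Altogether, when `d` has an edge, **the reached
sum of the unit of `ρ` is `EX(ρ) + Σ_{D ≠ A} K(ρ, D)`** (`sum_inner_eq`).  Own work; std
axioms.
-/

namespace Summit.Ventures.PercRepro2

namespace NoPocket

open Finset Classical RegionHub OneColourSwitch SideSwitch M9Reduce

variable {V : Type*} {E : Type*}

section UnitSum

variable [Fintype V] [DecidableEq V] [Fintype E] [DecidableEq E] {ends : E → Sym2 V}

/-- The all-dead pattern has no `Y`-reached point. -/
lemma inner_all_dead_eq_zero {p q r s d : V} (hnp : NoPocketAt ends d r s) (hr : d ≠ r)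
    (hs : d ≠ s) (hT : Tset ends d r s = ∅) {ρ : Config E} (hρ : ρ ∈ RepD ends p q r s d)
    (hst : ∀ e, d ∈ ends e → ρ e = true) :
    ∑ x ∈ L4 ends d r s (flipF (univ.filter (fun e => d ∈ ends e)) ρ),
      (if d ∈ K2 ends r s (assignX ends x (flipF (univ.filter (fun e => d ∈ ends e)) ρ)) then
        sigma ends (assignX ends x (flipF (univ.filter (fun e => d ∈ ends e)) ρ)) p q *
          sigma ends (assignX ends x (flipF (univ.filter (fun e => d ∈ ends e)) ρ)) r s
      else 0) = 0 := by
  have hρA := flipF_mem_RepD hρ hT (D := univ.filter (fun e => d ∈ ends e))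
    (fun e he => (Finset.mem_filter.1 he).2)
  refine Finset.sum_eq_zero (fun x hx => ?_)
  rw [if_neg]
  rw [d_mem_K2_assignX_iff_srcY hnp hr hs hρA hx]
  exact not_srcY_flipF_all hT hst x

/-- A pattern `∅ ≠ D ≠ A` contributes exactly its `K`-points. -/
lemma inner_eq_K_sum {p q r s d : V} (hnp : NoPocketAt ends d r s) (hr : d ≠ r) (hs : d ≠ s)
    (hT : Tset ends d r s = ∅) (hloop : ∀ e, ends e ≠ s(d, d)) {ρ : Config E}
    (hρ : ρ ∈ RepD ends p q r s d) (hst : ∀ e, d ∈ ends e → ρ e = true) {D : Finset E}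
    (hD : D ⊆ univ.filter (fun e => d ∈ ends e)) (hD0 : D ≠ ∅)
    (hDA : D ≠ univ.filter (fun e => d ∈ ends e)) {𝔉 : Finset (Finset V)}
    (h𝔉 : 𝔉 = (blocks ends d r s ρ).filter (fun C => ¬ hasY ends d ρ C)) :
    ∑ x ∈ L4 ends d r s (flipF D ρ),
      (if d ∈ K2 ends r s (assignX ends x (flipF D ρ)) then
        sigma ends (assignX ends x (flipF D ρ)) p q * sigma ends (assignX ends x (flipF D ρ)) r s
      else 0) =
      ∑ T ∈ 𝔉.powerset, sigma ends (assignX ends (T, ∅) (flipF D ρ)) p q *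
        sigma ends (assignX ends (T, ∅) (flipF D ρ)) r s := by
  have hDd : ∀ e ∈ D, d ∈ ends e := fun e he => (Finset.mem_filter.1 (hD he)).2
  have hρD := flipF_mem_RepD hρ hT hDd
  rw [← Finset.sum_filter]
  subst h𝔉
  refine Finset.sum_nbij' (fun x => x.1) (fun T => (T, ∅)) ?_ ?_ ?_ ?_ ?_
  · intro x hx
    obtain ⟨hxL, hxK⟩ := Finset.mem_filter.1 hx
    rw [d_mem_K2_assignX_iff_srcY hnp hr hs hρD hxL] at hxK
    exact Finset.mem_powerset.2
      ((mem_L4_srcY_flipF_iff hnp hr hs hT hloop hst hD hD0 hDA).1 ⟨hxL, hxK⟩).1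
  · intro T hTp
    have h := (mem_L4_srcY_flipF_iff hnp hr hs hT hloop hst hD hD0 hDA
      (x := (T, ∅))).2 ⟨Finset.mem_powerset.1 hTp, rfl⟩
    exact Finset.mem_filter.2 ⟨h.1, (d_mem_K2_assignX_iff_srcY hnp hr hs hρD h.1).2 h.2⟩
  · intro x hx
    obtain ⟨hxL, hxK⟩ := Finset.mem_filter.1 hx
    rw [d_mem_K2_assignX_iff_srcY hnp hr hs hρD hxL] at hxK
    have h2 := ((mem_L4_srcY_flipF_iff hnp hr hs hT hloop hst hD hD0 hDA).1 ⟨hxL, hxK⟩).2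
    exact Prod.ext rfl h2.symm
  · intro T _
    rfl
  · intro x hx
    obtain ⟨hxL, hxK⟩ := Finset.mem_filter.1 hx
    rw [d_mem_K2_assignX_iff_srcY hnp hr hs hρD hxL] at hxK
    have h2 := ((mem_L4_srcY_flipF_iff hnp hr hs hT hloop hst hD hD0 hDA).1 ⟨hxL, hxK⟩).2
    have : x = (x.1, ∅) := Prod.ext rfl h2
    rw [← this]

omit [Fintype E] [DecidableEq E] in
/-- A block subset is the union of its free and its joined part. -/
lemma sum_powerset_blocks_eq {d r s : V} (ρ : Config E) (g : Finset (Finset V) → ℤ) :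
    ∑ X ∈ (blocks ends d r s ρ).powerset, g X =
      ∑ T ∈ ((blocks ends d r s ρ).filter (fun C => ¬ hasY ends d ρ C)).powerset,
        ∑ S ∈ ((blocks ends d r s ρ).filter (hasY ends d ρ)).powerset, g (T ∪ S) := by
  rw [← Finset.sum_product']
  refine Finset.sum_nbij' (fun X => (X ∩ (blocks ends d r s ρ).filter (fun C => ¬ hasY ends d ρ C),
    X ∩ (blocks ends d r s ρ).filter (hasY ends d ρ))) (fun x => x.1 ∪ x.2) ?_ ?_ ?_ ?_ ?_
  · intro X _
    exact Finset.mem_product.2 ⟨Finset.mem_powerset.2 Finset.inter_subset_right,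
      Finset.mem_powerset.2 Finset.inter_subset_right⟩
  · rintro ⟨T, S⟩ hx
    obtain ⟨hT, hS⟩ := Finset.mem_product.1 hx
    exact Finset.mem_powerset.2 (Finset.union_subset
      ((Finset.mem_powerset.1 hT).trans (Finset.filter_subset _ _))
      ((Finset.mem_powerset.1 hS).trans (Finset.filter_subset _ _)))
  · intro X hX
    have hXb := Finset.mem_powerset.1 hX
    simp only
    rw [← Finset.inter_union_distrib_left, free_union_joined]
    exact Finset.inter_eq_left.2 hXb
  · rintro ⟨T, S⟩ hx
    obtain ⟨hT, hS⟩ := Finset.mem_product.1 hx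
    have hT' := Finset.mem_powerset.1 hT
    have hS' := Finset.mem_powerset.1 hS
    simp only
    refine Prod.ext ?_ ?_
    · show (T ∪ S) ∩ _ = T
      rw [Finset.union_inter_distrib_right, Finset.inter_eq_left.2 hT']
      have : S ∩ (blocks ends d r s ρ).filter (fun C => ¬ hasY ends d ρ C) = ∅ := by
        rw [Finset.eq_empty_iff_forall_notMem]
        intro C hC
        obtain ⟨hCS, hCf⟩ := Finset.mem_inter.1 hC
        exact (Finset.mem_filter.1 hCf).2 (Finset.mem_filter.1 (hS' hCS)).2
      rw [this, Finset.union_empty]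
    · show (T ∪ S) ∩ _ = S
      rw [Finset.union_inter_distrib_right, Finset.inter_eq_left.2 hS']
      have : T ∩ (blocks ends d r s ρ).filter (hasY ends d ρ) = ∅ := by
        rw [Finset.eq_empty_iff_forall_notMem]
        intro C hC
        obtain ⟨hCT, hCj⟩ := Finset.mem_inter.1 hC
        exact (Finset.mem_filter.1 (hT' hCT)).2 (Finset.mem_filter.1 hCj).2
      rw [this, Finset.empty_union]
  · intro X hX
    have hXb := Finset.mem_powerset.1 hX
    simp only
    rw [← Finset.inter_union_distrib_left, free_union_joined, Finset.inter_eq_left.2 hXb]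

omit [Fintype E] [DecidableEq E] in
/-- The joined blocks lie in `T ∪ S` (`T` free, `S` joined) exactly when `S` is all of them. -/
lemma joined_subset_union_iff {d r s : V} (ρ : Config E) {T S : Finset (Finset V)}
    (hT : T ⊆ (blocks ends d r s ρ).filter (fun C => ¬ hasY ends d ρ C))
    (hS : S ⊆ (blocks ends d r s ρ).filter (hasY ends d ρ)) :
    (blocks ends d r s ρ).filter (hasY ends d ρ) ⊆ T ∪ S ↔
      S = (blocks ends d r s ρ).filter (hasY ends d ρ) := by
  constructor
  · intro h
    refine Finset.Subset.antisymm hS (fun C hC => ?_)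
    rcases Finset.mem_union.1 (h hC) with h' | h'
    · exact absurd (Finset.mem_filter.1 hC).2 (Finset.mem_filter.1 (hT h')).2
    · exact h'
  · rintro rfl
    exact Finset.subset_union_right

omit [DecidableEq E] in
/-- The subsets of a non-empty `N` other than `N` are `∅` and the proper ones. -/
lemma filter_ne_self_eq_insert {β : Type*} [DecidableEq β] {N : Finset β} (hN : N ≠ ∅) :
    N.powerset.filter (fun S => S ≠ N) =
      insert (∅ : Finset β) (N.powerset.filter (fun S => S ≠ ∅ ∧ S ≠ N)) := by
  ext S
  simp only [Finset.mem_filter, Finset.mem_powerset, Finset.mem_insert]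
  constructor
  · rintro ⟨hS, hSN⟩
    by_cases h0 : S = ∅
    · exact Or.inl h0
    · exact Or.inr ⟨hS, h0, hSN⟩
  · rintro (rfl | ⟨hS, _, hSN⟩)
    · exact ⟨Finset.empty_subset _, fun h => hN h.symm⟩
    · exact ⟨hS, hSN⟩

/-- **The pattern `D = ∅` contributes the doubly-reached points and the clean `K`-points.** -/
lemma inner_empty_eq {p q r s d : V} (hnp : NoPocketAt ends d r s) (hr : d ≠ r) (hs : d ≠ s)
    (hT : Tset ends d r s = ∅) {ρ : Config E} (hρ : ρ ∈ RepD ends p q r s d)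
    (hst : ∀ e, d ∈ ends e → ρ e = true) {𝔉 𝔑 : Finset (Finset V)}
    (h𝔉 : 𝔉 = (blocks ends d r s ρ).filter (fun C => ¬ hasY ends d ρ C))
    (h𝔑 : 𝔑 = (blocks ends d r s ρ).filter (hasY ends d ρ)) (h𝔑0 : 𝔑 ≠ ∅) :
    ∑ x ∈ L4 ends d r s ρ,
      (if d ∈ K2 ends r s (assignX ends x ρ) then
        sigma ends (assignX ends x ρ) p q * sigma ends (assignX ends x ρ) r s else 0) =
      (∑ T ∈ 𝔉.powerset, ∑ S ∈ 𝔑.powerset.filter (fun S => S ≠ ∅ ∧ S ≠ 𝔑),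
        sigma ends (assignX ends (T ∪ S, ∅) ρ) p q * sigma ends (assignX ends (T ∪ S, ∅) ρ) r s) +
      ∑ T ∈ 𝔉.powerset, sigma ends (assignX ends (T, ∅) ρ) p q *
        sigma ends (assignX ends (T, ∅) ρ) r s := by
  rw [sum_L4_sameType hT hst, sum_powerset_blocks_eq ρ, ← h𝔉, ← h𝔑]
  have hinner : ∀ T ∈ 𝔉.powerset, ∑ S ∈ 𝔑.powerset,
      (if d ∈ K2 ends r s (assignX ends (T ∪ S, ∅) ρ) then
        sigma ends (assignX ends (T ∪ S, ∅) ρ) p q * sigma ends (assignX ends (T ∪ S, ∅) ρ) r s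
      else 0) =
      sigma ends (assignX ends (T, ∅) ρ) p q * sigma ends (assignX ends (T, ∅) ρ) r s +
      ∑ S ∈ 𝔑.powerset.filter (fun S => S ≠ ∅ ∧ S ≠ 𝔑),
        sigma ends (assignX ends (T ∪ S, ∅) ρ) p q * sigma ends (assignX ends (T ∪ S, ∅) ρ) r s := by
    intro T hTp
    have hTf : T ⊆ (blocks ends d r s ρ).filter (fun C => ¬ hasY ends d ρ C) := by
      rw [← h𝔉]; exact Finset.mem_powerset.1 hTp
    have hcond : ∀ S ∈ 𝔑.powerset, (d ∈ K2 ends r s (assignX ends (T ∪ S, ∅) ρ) ↔ S ≠ 𝔑) := by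
      intro S hS
      have hSj : S ⊆ (blocks ends d r s ρ).filter (hasY ends d ρ) := by
        rw [← h𝔑]; exact Finset.mem_powerset.1 hS
      have hX : T ∪ S ⊆ blocks ends d r s ρ := Finset.union_subset
        (hTf.trans (Finset.filter_subset _ _)) (hSj.trans (Finset.filter_subset _ _))
      rw [d_mem_K2_assignX_sameType_iff hnp hr hs hT hρ hst hX, joined_subset_union_iff ρ hTf hSj,
        ← h𝔑]
    rw [Finset.sum_congr rfl (fun S hS => by rw [if_congr (hcond S hS) rfl rfl]),
      ← Finset.sum_filter, filter_ne_self_eq_insert h𝔑0,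
      Finset.sum_insert (fun h => (mem_properOf.1 h).2.1 rfl), Finset.union_empty]
  rw [Finset.sum_congr rfl hinner, Finset.sum_add_distrib, add_comm]

/-- **The reached sum of the unit of a same-type representative** (when `d` has an edge):
the doubly-reached points plus the `K`-points of every pattern other than the all-dead one. -/
theorem sum_inner_eq {p q r s d : V} (hnp : NoPocketAt ends d r s) (hr : d ≠ r) (hs : d ≠ s)
    (hT : Tset ends d r s = ∅) (hloop : ∀ e, ends e ≠ s(d, d)) {ρ : Config E}
    (hρ : ρ ∈ RepD ends p q r s d) (hst : ∀ e, d ∈ ends e → ρ e = true)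
    (hA : univ.filter (fun e => d ∈ ends e) ≠ ∅) {𝔉 𝔑 : Finset (Finset V)}
    (h𝔉 : 𝔉 = (blocks ends d r s ρ).filter (fun C => ¬ hasY ends d ρ C))
    (h𝔑 : 𝔑 = (blocks ends d r s ρ).filter (hasY ends d ρ)) :
    ∑ D ∈ (univ.filter (fun e => d ∈ ends e)).powerset, ∑ x ∈ L4 ends d r s (flipF D ρ),
      (if d ∈ K2 ends r s (assignX ends x (flipF D ρ)) then
        sigma ends (assignX ends x (flipF D ρ)) p q * sigma ends (assignX ends x (flipF D ρ)) r s
      else 0) =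
      (∑ T ∈ 𝔉.powerset, ∑ S ∈ 𝔑.powerset.filter (fun S => S ≠ ∅ ∧ S ≠ 𝔑),
        sigma ends (assignX ends (T ∪ S, ∅) ρ) p q * sigma ends (assignX ends (T ∪ S, ∅) ρ) r s) +
      ∑ D ∈ (univ.filter (fun e => d ∈ ends e)).powerset.filter
          (fun D => D ≠ univ.filter (fun e => d ∈ ends e)),
        ∑ T ∈ 𝔉.powerset, sigma ends (assignX ends (T, ∅) (flipF D ρ)) p q *
          sigma ends (assignX ends (T, ∅) (flipF D ρ)) r s := by
  -- the joined blocks are non-empty: some edge at `d` enters a block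
  have h𝔑0 : 𝔑 ≠ ∅ := by
    obtain ⟨e, he⟩ := Finset.nonempty_iff_ne_empty.2 hA
    obtain ⟨C, hC, y, hyC, hends⟩ :=
      exists_block_of_edge_at_d hnp hr hs hT hloop ρ (Finset.mem_filter.1 he).2
    intro h0
    have : C ∈ 𝔑 := by
      rw [h𝔑]
      exact Finset.mem_filter.2 ⟨hC, (hasY_sameType_iff hst C).2 ⟨e, y, hyC, hends⟩⟩
    rw [h0] at this
    exact Finset.notMem_empty C this
  conv_lhs => rw [powerset_eq_insert_properOf hA]
  conv_rhs => rw [filter_ne_self_eq_insert hA]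
  rw [Finset.sum_insert (empty_notMem_insert_properOf hA),
    Finset.sum_insert (self_notMem_properOf _), inner_all_dead_eq_zero hnp hr hs hT hρ hst,
    zero_add, flipF_empty, inner_empty_eq hnp hr hs hT hρ hst h𝔉 h𝔑 h𝔑0,
    Finset.sum_insert (fun h => (mem_properOf.1 h).2.1 rfl), flipF_empty]
  rw [Finset.sum_congr rfl (fun D hD => inner_eq_K_sum hnp hr hs hT hloop hρ hst
    (mem_properOf.1 hD).1 (mem_properOf.1 hD).2.1 (mem_properOf.1 hD).2.2 h𝔉)]
  ring

end UnitSum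

end NoPocket

end Summit.Ventures.PercRepro2
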